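import Literature.RingTheory.KrullDimension.GenericAvoidance
import Mathlib.AlgebraicGeometry.ZariskisMainTheorem
import Mathlib.RingTheory.Artinian.Ring
import HarnessLib

/-!
# A generic member of a linear system contains no component of any fibre of a curve fibration (affine form)

Topic: `Literature/AlgebraicGeometry/Resolution`. The first genericity statement in de Jong's
proof of his multisection lemma (de Jong 1996, Lemma 4.13, pp. 69–70): for a projective
morphism `f : X → Y` all of whose fibres are curves and forms `G` of large degree on the
ambient projective space, "`T = {(H, y) ∈ 𝐏^∨ × Y | dim f⁻¹(y) ∩ H = 1}` […]
`dim T ≤ dim Y + dim 𝐏^∨ - n` […] In particular, `pr₁(T) ≠ 𝐏^∨`": the generic hypersurface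
contains no irreducible component of any fibre. We prove the affine, chart-wise form that the
scheme-theoretic argument reduces to (`exists_ne_zero_forall_sum_smul_notMem_minimalPrimes`):

Let `k` be algebraically closed, `φ : B → A` a `k`-algebra map of finitely generated
`k`-algebras (a chart `Spec A → Spec B` of `f`) with `dim A ≤ e`, and `c : ι → A` finitely many
functions (the restrictions of the monomials of degree `m`), such that for every closed point
`𝔫` of `Spec B` every irreducible component `V(P)` of the fibre `V(𝔫A)` is a curve
(`dim A/P = 1`) on which the `c_i` span a `k`-space of dimension `≥ e + 1`. Then there is a
non-zero polynomial `h ∈ k[T_i : i ∈ ι]` such that for every `a ∈ k^ι` with `h(a) ≠ 0` the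
function `g_a = Σ aᵢ cᵢ` lies in no minimal prime of any `𝔫A` — `V(g_a)` contains no component
of any closed fibre.

Proof. In `Spec A[T] ⊇ V(𝔤)`, `𝔤 = Σ Tᵢ cᵢ` the universal member, let `E` be the set of
points at which `V(𝔤) → Spec B[T]` is not quasi-finite; it is closed (Zariski's Main Theorem,
Mathlib `Scheme.Hom.isOpen_quasiFiniteAt`). A closed point `(x, a)` of `V(𝔤)` lies in `E` iff
`x` is not isolated in `V(g_a) ∩ V(𝔫A)` (`𝔫` the image of `x`), iff `g_a` lies in a minimal
prime `P ⊆ 𝔪_x` of `𝔫A` (the components of the fibre through `x` are curves, so `V(g_a)`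
meets those not containing it in finitely many closed points): `not_quasiFiniteAt_of_mem`,
`exists_mem_minimalPrimes_of_not_quasiFiniteAt`. Hence over `x` the bad parameters form the
union of the linear subspaces `{a | g_a ∈ P}`, of codimension `≥ e + 1` by the span hypothesis,
and generic avoidance (`Literature.RingTheory.KrullDimension.exists_ne_zero_forall_mem_of_isMaximal`,
the dimension count `dim E ≤ dim A + (#ι - e - 1) < #ι`) produces `h`.

## References

* A. J. de Jong, *Smoothness, semi-stability and alterations*, Publ. Math. IHÉS 83 (1996),
  Lemma 4.13 (proof), pp. 69–70. [DeJong1996]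
* R. Hartshorne, *Algebraic Geometry*, GTM 52 (1977), II Thm. 8.18 (proof: the dimension
  count for the bad hyperplanes). [Hartshorne1977]
-/

noncomputable section

open MvPolynomial AlgebraicGeometry PrimeSpectrum Topology

namespace Literature.AlgebraicGeometry.Resolution

universe u v

/-! ### The ideal of a rational point of `Spec A[T]` over `Spec A` -/

section PointIdeal

variable {A : Type*} [CommRing A] {ι : Type*}

/-- **Taylor expansion at a point, to first order**: `p ≡ p(y) mod (Tᵢ - yᵢ)ᵢ` in `A[T]`.
[folklore] -/
theorem sub_C_eval_mem_span (y : ι → A) (p : MvPolynomial ι A) :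
    p - C (eval y p) ∈ Ideal.span (Set.range fun i => (X i - C (y i) : MvPolynomial ι A)) := by
  induction p using MvPolynomial.induction_on with
  | C a => simp
  | add p q hp hq =>
    have : p + q - C (eval y (p + q)) = (p - C (eval y p)) + (q - C (eval y q)) := by
      simp only [map_add]; ring
    rw [this]
    exact Ideal.add_mem _ hp hq
  | mul_X p i hp =>
    have : p * X i - C (eval y (p * X i)) =
        (p - C (eval y p)) * X i + C (eval y p) * (X i - C (y i)) := by
      simp only [map_mul, eval_X, map_mul]; ring
    rw [this]
    exact Ideal.add_mem _ (Ideal.mul_mem_right _ _ hp)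
      (Ideal.mul_mem_left _ _ (Ideal.subset_span ⟨i, rfl⟩))

/-- The kernel of the evaluation `A[T] → A` at `y` lies in every ideal containing the
`Tᵢ - yᵢ`. [folklore] -/
theorem ker_eval_le_of_forall_X_sub_C_mem (y : ι → A) {𝔓 : Ideal (MvPolynomial ι A)}
    (h : ∀ i, X i - C (y i) ∈ 𝔓) : RingHom.ker (eval y) ≤ 𝔓 := by
  intro p hp
  rw [RingHom.mem_ker] at hp
  have h1 := sub_C_eval_mem_span y p
  rw [hp, map_zero, sub_zero] at h1
  exact (Ideal.span_le.mpr (Set.range_subset_iff.mpr h) : _ ≤ 𝔓) h1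

/-- An ideal of `A[T]` containing the `Tᵢ - yᵢ` is the contraction of its image in `A` under
evaluation at `y`. [folklore] -/
theorem comap_eval_map_eval_eq (y : ι → A) {𝔓 : Ideal (MvPolynomial ι A)}
    (h : ∀ i, X i - C (y i) ∈ 𝔓) : (𝔓.map (eval y)).comap (eval y) = 𝔓 := by
  rw [Ideal.comap_map_of_surjective (eval y) (fun a => ⟨C a, eval_C a⟩), ← RingHom.ker_eq_comap_bot,
    sup_eq_left.mpr (ker_eval_le_of_forall_X_sub_C_mem y h)]

/-- For an ideal `𝔐` of `A[T]` containing the `Tᵢ - yᵢ`, its image under evaluation at `y` is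
its contraction `𝔐 ∩ A` along the constants. [folklore] -/
theorem map_eval_eq_comap_C (y : ι → A) {𝔐 : Ideal (MvPolynomial ι A)}
    (h : ∀ i, X i - C (y i) ∈ 𝔐) : 𝔐.map (eval y) = 𝔐.comap (C : A →+* MvPolynomial ι A) := by
  apply le_antisymm
  · rw [Ideal.map_le_iff_le_comap]
    intro p hp
    rw [Ideal.mem_comap, Ideal.mem_comap]
    have h1 := ker_eval_le_of_forall_X_sub_C_mem y h
      (show p - C (eval y p) ∈ RingHom.ker (eval y) by simp [RingHom.mem_ker])
    have : C (eval y p) = p - (p - C (eval y p)) := by ring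
    rw [this]
    exact Ideal.sub_mem _ hp h1
  · intro x hx
    rw [Ideal.mem_comap] at hx
    have : x = eval y (C x) := (eval_C x).symm
    rw [this]
    exact Ideal.mem_map_of_mem _ hx

/-- An ideal `𝔐` of `A[T]` containing the `Tᵢ - yᵢ` is the contraction of `𝔐 ∩ A` under
evaluation at `y`: `𝔐 = {p | p(y) ∈ 𝔐 ∩ A}`. [folklore] -/
theorem eq_comap_eval_comap_C (y : ι → A) {𝔐 : Ideal (MvPolynomial ι A)}
    (h : ∀ i, X i - C (y i) ∈ 𝔐) :
    𝔐 = (𝔐.comap (C : A →+* MvPolynomial ι A)).comap (eval y) := by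
  rw [← map_eval_eq_comap_C y h, comap_eval_map_eval_eq y h]

end PointIdeal

/-! ### Quasi-finiteness at a point, topologically -/

/-- **A morphism locally of finite type is quasi-finite at `x` iff `x` is isolated among the
points with the same image** (Mathlib's `quasiFiniteAt_iff_isOpen_singleton_asFiber`, read in
`X` through `Scheme.Hom.fiberHomeo`). [folklore] -/
theorem quasiFiniteAt_iff_exists_isOpen {X Y : Scheme.{u}} (f : X ⟶ Y) [LocallyOfFiniteType f]
    (x : X) :
    f.QuasiFiniteAt x ↔ ∃ U : Set X, IsOpen U ∧ x ∈ U ∧ ∀ y, f y = f x → y ∈ U → y = x := by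
  rw [Scheme.Hom.quasiFiniteAt_iff_isOpen_singleton_asFiber,
    ← (f.fiberHomeo (f x)).isOpen_image, Set.image_singleton]
  change IsOpen ({(f.fiberHomeo (f x)) ((f.fiberHomeo (f x)).symm ⟨x, rfl⟩)} :
    Set (f ⁻¹' {f x})) ↔ _
  rw [Homeomorph.apply_symm_apply, isOpen_induced_iff]
  constructor
  · rintro ⟨t, ht, hts⟩
    refine ⟨t, ht, ?_, fun y hy hyt => ?_⟩
    · have : (⟨x, rfl⟩ : f ⁻¹' {f x}) ∈ Subtype.val ⁻¹' t := by
        rw [hts]; exact Set.mem_singleton _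
      exact this
    · have : (⟨y, hy⟩ : f ⁻¹' {f x}) ∈ Subtype.val ⁻¹' t := hyt
      rw [hts] at this
      exact congrArg Subtype.val (Set.mem_singleton_iff.mp this)
  · rintro ⟨U, hU, hxU, hUx⟩
    refine ⟨U, hU, Set.ext fun y => ⟨fun hy => ?_, fun hy => ?_⟩⟩
    · exact Set.mem_singleton_iff.mpr (Subtype.ext (hUx y y.2 hy))
    · rw [Set.mem_singleton_iff.mp hy]; exact hxU

/-! ### Proper closed subsets of an affine curve are finite sets of closed points -/

section DimZero

variable {A : Type*} [CommRing A] [IsNoetherianRing A]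

omit [IsNoetherianRing A] in
/-- For a prime `P` with `dim A/P ≤ 1` and `g ∉ P`, the ring `A/(P + (g))` has dimension
`≤ 0`. [folklore] -/
theorem ringKrullDim_quotient_sup_span_le_zero {P : Ideal A} [P.IsPrime]
    (hP : ringKrullDim (A ⧸ P) ≤ 1) {g : A} (hg : g ∉ P) :
    ringKrullDim (A ⧸ (P ⊔ Ideal.span {g})) ≤ 0 := by
  haveI : IsDomain (A ⧸ P) := Ideal.Quotient.isDomain P
  have hne : Ideal.Quotient.mk P g ≠ 0 := fun h => hg (Ideal.Quotient.eq_zero_iff_mem.mp h)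
  have h1 := ringKrullDim_quotient_succ_le_of_nonZeroDivisor (mem_nonZeroDivisors_of_ne_zero hne)
  have e : (A ⧸ P) ⧸ Ideal.span {Ideal.Quotient.mk P g} ≃+* A ⧸ (P ⊔ Ideal.span {g}) := by
    have h := (DoubleQuot.quotQuotEquivQuotSup P (Ideal.span {g}))
    rwa [Ideal.map_span, Set.image_singleton] at h
  rw [← ringKrullDim_eq_of_ringEquiv e]
  -- `d + 1 ≤ 1` gives `d ≤ 0`
  have h2 := h1.trans hP
  revert h2
  generalize ringKrullDim ((A ⧸ P) ⧸ Ideal.span {(Ideal.Quotient.mk P) g}) = d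
  intro h2
  induction d with
  | bot => exact bot_le
  | coe d =>
    induction d with
    | top => exact absurd h2 (by decide)
    | coe n =>
      have : ((n + 1 : ℕ) : WithBot ℕ∞) ≤ (1 : ℕ) := by exact_mod_cast h2
      have h3 : n + 1 ≤ 1 := by exact_mod_cast this
      have h4 : n = 0 := by omega
      subst h4
      exact le_rfl

/-- The primes containing an ideal `I` with `dim A/I ≤ 0` form a finite set of closed points.
[folklore] -/
theorem finite_and_isClosed_of_ringKrullDim_le_zero {I : Ideal A} (hI : ringKrullDim (A ⧸ I) ≤ 0) :
    {𝔮 : PrimeSpectrum A | I ≤ 𝔮.asIdeal}.Finite ∧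
      ∀ 𝔮 : PrimeSpectrum A, I ≤ 𝔮.asIdeal → 𝔮.asIdeal.IsMaximal := by
  haveI h0 : Ring.KrullDimLE 0 (A ⧸ I) := Ring.krullDimLE_iff.mpr hI
  haveI : IsArtinianRing (A ⧸ I) :=
    isArtinianRing_iff_isNoetherianRing_krullDimLE_zero.mpr ⟨inferInstance, h0⟩
  have hrange : {𝔮 : PrimeSpectrum A | I ≤ 𝔮.asIdeal} =
      Set.range (comap (Ideal.Quotient.mk I)) := by
    rw [range_comap_of_surjective _ _ Ideal.Quotient.mk_surjective, Ideal.mk_ker]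
    ext 𝔮
    simp [mem_zeroLocus, SetLike.coe_subset_coe]
  refine ⟨hrange ▸ Set.finite_range _, fun 𝔮 h𝔮 => ?_⟩
  have hmem : 𝔮 ∈ Set.range (comap (Ideal.Quotient.mk I)) := hrange ▸ h𝔮
  obtain ⟨𝔮', rfl⟩ := hmem
  haveI : 𝔮'.asIdeal.IsMaximal := Ideal.isMaximal_of_isPrime 𝔮'.asIdeal
  exact Ideal.comap_isMaximal_of_surjective _ Ideal.Quotient.mk_surjective

end DimZero

/-! ### The universal member of a linear system and its quasi-finite locus -/

section Universal

variable (k : Type u) [Field k] {A : Type u} {B : Type u} [CommRing A] [CommRing B]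
  [Algebra k A] [Algebra k B] (φ : B →ₐ[k] A) {ι : Type v} [Fintype ι] (c : ι → A)

/-- The **universal member** `𝔤 = Σᵢ Tᵢ cᵢ ∈ A[Tᵢ : i ∈ ι]` of the linear system spanned by
functions `cᵢ ∈ A`: its value at the parameter `a ∈ kᶥ` is `g_a = Σᵢ aᵢ cᵢ`. [folklore] -/
def univComb : MvPolynomial ι A := ∑ i, X i * C (c i)

/-- The coordinate ring `A[T]/(𝔤)` of the total space `{(x, a) | g_a(x) = 0}` of the linear
system. [folklore] -/
abbrev UnivQuot : Type (max u v) := MvPolynomial ι A ⧸ Ideal.span {univComb c}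

/-- The structure map `B[T] → A[T]/(𝔤)` of the total space over `Spec B × 𝔸ᶥ`, for a chart
`φ : B → A`. [folklore] -/
def univHom : MvPolynomial ι B →+* UnivQuot c :=
  (Ideal.Quotient.mk (Ideal.span {univComb c})).comp (MvPolynomial.map (φ : B →+* A))

/-- The morphism `{(x, a) | g_a(x) = 0} → Spec B × 𝔸ᶥ`. [folklore] -/
abbrev univMor : Spec (CommRingCat.of (UnivQuot c)) ⟶ Spec (CommRingCat.of (MvPolynomial ι B)) :=
  Spec.map (CommRingCat.ofHom (univHom k φ c))

/-- Evaluation of the parameters at `a ∈ kᶥ`: `A[T] → A`, `Tᵢ ↦ aᵢ`. [folklore] -/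
abbrev evalParams (a : ι → k) : MvPolynomial ι A →+* A := eval fun i => algebraMap k A (a i)

/-- `𝔤(a) = g_a = Σᵢ aᵢ cᵢ`. [folklore] -/
theorem evalParams_univComb (a : ι → k) : evalParams k a (univComb c) = ∑ i, a i • c i := by
  simp [univComb, evalParams, map_sum, Algebra.smul_def]

omit [Fintype ι] in
/-- Evaluation at `a` is surjective. [folklore] -/
theorem evalParams_surjective (a : ι → k) : Function.Surjective (evalParams k (A := A) a) :=
  fun x => ⟨C x, eval_C x⟩

omit [Fintype ι] in
/-- Evaluation at `a` commutes with the chart map: `evₐ ∘ φ[T] = φ ∘ evₐ`. [folklore] -/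
theorem evalParams_comp_map (a : ι → k) :
    (evalParams k a).comp (MvPolynomial.map (φ : B →+* A)) =
      (φ : B →+* A).comp (eval fun i => algebraMap k B (a i)) := by
  apply MvPolynomial.ringHom_ext
  · intro b
    simp [evalParams]
  · intro i
    simp [evalParams]

/-- The points of the total space, as primes of `A[T]`: the value of `univMor` at `𝔔` is the
contraction of `𝔔 ∩ A[T]` to `B[T]`. [folklore] -/
theorem univMor_apply_asIdeal (𝔔 : PrimeSpectrum (UnivQuot c)) :
    ((univMor k φ c) 𝔔).asIdeal =
      (𝔔.asIdeal.comap (Ideal.Quotient.mk (Ideal.span {univComb c}))).comap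
        (MvPolynomial.map (φ : B →+* A)) := by
  rw [Ideal.comap_comap]
  rfl

variable [Algebra.FiniteType k A] [Algebra.FiniteType k B]

omit [Algebra.FiniteType k B] in
include k in
/-- The total space is locally of finite type over `Spec B × 𝔸ᶥ`. [folklore] -/
theorem locallyOfFiniteType_univMor : LocallyOfFiniteType (univMor k φ c) := by
  rw [HasRingHomProperty.Spec_iff (P := @LocallyOfFiniteType)]
  change (univHom k φ c).FiniteType
  haveI : Algebra.FiniteType k (MvPolynomial ι A) :=
    (inferInstance : Algebra.FiniteType k A).trans inferInstance
  haveI : Algebra.FiniteType k (UnivQuot c) :=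
    Algebra.FiniteType.of_surjective (Ideal.Quotient.mkₐ k _) Ideal.Quotient.mk_surjective
  refine RingHom.FiniteType.of_comp_finiteType (f := algebraMap k (MvPolynomial ι B)) ?_
  have : (univHom k φ c).comp (algebraMap k (MvPolynomial ι B)) = algebraMap k (UnivQuot c) := by
    apply RingHom.ext
    intro t
    change Ideal.Quotient.mk _ (MvPolynomial.map (φ : B →+* A) (algebraMap k (MvPolynomial ι B) t)) = _
    rw [MvPolynomial.algebraMap_apply, MvPolynomial.map_C, RingHom.coe_coe, AlgHom.commutes]
    rfl
  rw [this]
  exact RingHom.finiteType_algebraMap.mpr inferInstance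

end Universal

/-! ### Points of the total space over closed points of `Spec A`, and their images -/

section Points

variable (k : Type u) [Field k] {A : Type u} {B : Type u} [CommRing A] [CommRing B]
  [Algebra k A] [Algebra k B] (φ : B →ₐ[k] A) {ι : Type v} [Fintype ι] (c : ι → A)

omit [Fintype ι] in
/-- `φ[T](Tᵢ - aᵢ) = Tᵢ - aᵢ`. [folklore] -/
theorem map_X_sub_C (a : ι → k) (i : ι) :
    MvPolynomial.map (φ : B →+* A) (X i - C (algebraMap k B (a i))) =
      X i - C (algebraMap k A (a i)) := by
  simp

omit [Fintype ι] in
/-- `evₐ(q ⊗ 1) = q(a)` for `q ∈ k[T]`: evaluating the scalar extension of `q` at `a`.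
[folklore] -/
theorem evalParams_map_algebraMap (a : ι → k) (q : MvPolynomial ι k) :
    evalParams k (A := A) a (MvPolynomial.map (algebraMap k A) q) = algebraMap k A (eval a q) := by
  rw [evalParams, eval_map, ← coe_eval₂Hom, show algebraMap k A (eval a q) =
    ((algebraMap k A).comp (eval a)) q from rfl]
  congr 1
  apply MvPolynomial.ringHom_ext
  · intro t; simp
  · intro i; simp

/-- The universal member lies in the contraction of every ideal containing `g_a`. [folklore] -/
theorem univComb_mem_comap_evalParams (a : ι → k) {𝔪 : Ideal A} (h : ∑ i, a i • c i ∈ 𝔪) :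
    univComb c ∈ 𝔪.comap (evalParams k a) := by
  rw [Ideal.mem_comap, evalParams_univComb]
  exact h

/-- The kernel `(𝔤)` of `A[T] → A[T]/(𝔤)` lies in the contraction of every ideal containing
`g_a`. [folklore] -/
theorem ker_mk_le_comap_evalParams (a : ι → k) {𝔪 : Ideal A} (h : ∑ i, a i • c i ∈ 𝔪) :
    RingHom.ker (Ideal.Quotient.mk (Ideal.span {univComb c})) ≤ 𝔪.comap (evalParams k a) := by
  rw [Ideal.mk_ker, Ideal.span_le, Set.singleton_subset_iff]
  exact univComb_mem_comap_evalParams k c a h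

/-- **The point `(x, a)` of the total space `{g_a(x) = 0}`** over a point `x = 𝔪 ∋ g_a` of
`Spec A` and a parameter `a ∈ kᶥ`: the prime `{p | p(a) ∈ 𝔪}/(𝔤)` of `A[T]/(𝔤)`. [folklore] -/
def pointOver (a : ι → k) (𝔪 : Ideal A) [𝔪.IsPrime] (h : ∑ i, a i • c i ∈ 𝔪) :
    PrimeSpectrum (UnivQuot c) :=
  ⟨(𝔪.comap (evalParams k a)).map (Ideal.Quotient.mk (Ideal.span {univComb c})),
    Ideal.map_isPrime_of_surjective Ideal.Quotient.mk_surjective (ker_mk_le_comap_evalParams k c a h)⟩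

/-- The point `(x, a)` as a prime of `A[T]`: `{p | p(a) ∈ 𝔪}`. [folklore] -/
theorem comap_mk_pointOver (a : ι → k) (𝔪 : Ideal A) [𝔪.IsPrime] (h : ∑ i, a i • c i ∈ 𝔪) :
    (pointOver k c a 𝔪 h).asIdeal.comap (Ideal.Quotient.mk (Ideal.span {univComb c})) =
      𝔪.comap (evalParams k a) := by
  change ((𝔪.comap (evalParams k a)).map _).comap _ = _
  rw [Ideal.comap_map_of_surjective _ Ideal.Quotient.mk_surjective, ← RingHom.ker_eq_comap_bot,
    sup_eq_left.mpr (ker_mk_le_comap_evalParams k c a h)]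

/-- **The image of `(x, a)` in `Spec B × 𝔸ᶥ`** is the point `(φ⁻¹ 𝔪, a)`:
`{q | q(a) ∈ φ⁻¹ 𝔪}`. [folklore] -/
theorem univMor_pointOver (a : ι → k) (𝔪 : Ideal A) [𝔪.IsPrime] (h : ∑ i, a i • c i ∈ 𝔪) :
    ((univMor k φ c) (pointOver k c a 𝔪 h)).asIdeal =
      (𝔪.comap (φ : B →+* A)).comap (eval fun i => algebraMap k B (a i)) := by
  rw [univMor_apply_asIdeal, comap_mk_pointOver, Ideal.comap_comap, evalParams_comp_map,
    ← Ideal.comap_comap]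

/-- **The fibre of the total space over `(𝔫, a)`**, for a closed point `𝔫` of `Spec B`: a point
`𝔔` maps to `(𝔫, a) = {q | q(a) ∈ 𝔫}` iff `𝔔 ∩ A[T]` contains the extension of that maximal
ideal. [folklore] -/
theorem univMor_apply_eq_iff (𝔫 : Ideal B) [𝔫.IsMaximal] (a : ι → k)
    (𝔔 : PrimeSpectrum (UnivQuot c)) :
    ((univMor k φ c) 𝔔).asIdeal = 𝔫.comap (eval fun i => algebraMap k B (a i)) ↔
      (𝔫.comap (eval fun i => algebraMap k B (a i))).map (MvPolynomial.map (φ : B →+* A)) ≤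
        𝔔.asIdeal.comap (Ideal.Quotient.mk (Ideal.span {univComb c})) := by
  have hmax : (𝔫.comap (eval fun i => algebraMap k B (a i))).IsMaximal :=
    Ideal.comap_isMaximal_of_surjective _ fun b => ⟨C b, eval_C b⟩
  rw [univMor_apply_asIdeal, Ideal.map_le_iff_le_comap]
  constructor
  · intro h
    exact h ▸ le_rfl
  · intro h
    exact (hmax.eq_of_le (Ideal.comap_ne_top _ (Ideal.IsPrime.ne_top inferInstance)) h).symm

end Points

/-! ### Closed points of the non-quasi-finite locus -/

section Directions

variable (k : Type u) [Field k] {A : Type u} {B : Type u} [CommRing A] [CommRing B]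
  [Algebra k A] [Algebra k B] (φ : B →ₐ[k] A) {ι : Type v} [Fintype ι] (c : ι → A)

/-- **If `(x, a)` is not isolated in its fibre, `g_a` vanishes on a component of the fibre of
`Spec A → Spec B` through `x`.** Let `𝔪 ∋ g_a` be a closed point of `Spec A` over the closed
point `𝔫 = φ⁻¹𝔪`, and suppose every component `V(P)` of the fibre `V(𝔫A)` has
`dim A/P ≤ 1`. If `{g_a = 0} → Spec B × 𝔸ᶥ` is not quasi-finite at `(x, a)`, then some
minimal prime `P ⊆ 𝔪` of `𝔫A` contains `g_a`. (Otherwise `V(g_a)` meets the curves `V(P)`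
through `x` in finitely many closed points and misses a neighbourhood of `x` on the other
components, so `x` is isolated in `V(g_a) ∩ V(𝔫A)`, which is the fibre through `(x, a)`.)
[cite: DeJong1996, Lemma 4.13 (proof), p. 69] -/
theorem exists_mem_minimalPrimes_of_not_quasiFiniteAt [IsNoetherianRing A]
    [LocallyOfFiniteType (univMor k φ c)] (a : ι → k) (𝔪 : Ideal A) [h𝔪 : 𝔪.IsMaximal]
    (hg : ∑ i, a i • c i ∈ 𝔪)
    (hdim : ∀ P ∈ ((𝔪.comap (φ : B →+* A)).map (φ : B →+* A)).minimalPrimes,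
      ringKrullDim (A ⧸ P) ≤ 1)
    (hnq : ¬ (univMor k φ c).QuasiFiniteAt (pointOver k c a 𝔪 hg)) :
    ∃ P ∈ ((𝔪.comap (φ : B →+* A)).map (φ : B →+* A)).minimalPrimes,
      P ≤ 𝔪 ∧ ∑ i, a i • c i ∈ P := by
  classical
  by_contra hcon
  push Not at hcon
  apply hnq
  -- notation
  set 𝔫A : Ideal A := (𝔪.comap (φ : B →+* A)).map (φ : B →+* A) with h𝔫A
  set g : A := ∑ i, a i • c i with hgdef
  have hfin : 𝔫A.minimalPrimes.Finite := 𝔫A.finite_minimalPrimes_of_isNoetherianRing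
  let ιA : PrimeSpectrum A → PrimeSpectrum (MvPolynomial ι A) := comap (evalParams k a)
  have hιA : IsClosedEmbedding ιA :=
    isClosedEmbedding_comap_of_surjective _ _ (evalParams_surjective k a)
  let mkg := Ideal.Quotient.mk (Ideal.span {univComb c})
  let ιS : PrimeSpectrum (UnivQuot c) → PrimeSpectrum (MvPolynomial ι A) := comap mkg
  have hιS : IsClosedEmbedding ιS :=
    isClosedEmbedding_comap_of_surjective _ _ Ideal.Quotient.mk_surjective
  let 𝔪pt : PrimeSpectrum A := ⟨𝔪, h𝔪.isPrime⟩
  -- the components of the fibre not through `x`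
  let Ψ : Set (PrimeSpectrum A) :=
    ⋃ P ∈ {P ∈ 𝔫A.minimalPrimes | ¬ P ≤ 𝔪}, zeroLocus (P : Set A)
  have hΨ : IsClosed Ψ :=
    (hfin.subset (Set.sep_subset _ _)).isClosed_biUnion fun P _ => isClosed_zeroLocus _
  have h𝔪Ψ : 𝔪pt ∉ Ψ := by
    intro h
    simp only [Ψ, Set.mem_iUnion, Set.mem_setOf_eq, mem_zeroLocus, SetLike.coe_subset_coe,
      exists_prop] at h
    obtain ⟨P, ⟨-, hP𝔪⟩, hle⟩ := h
    exact hP𝔪 hle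
  -- the finitely many other points of `V(g_a)` on the components through `x`
  let Φ : Set (PrimeSpectrum A) :=
    {𝔮 | 𝔮 ≠ 𝔪pt ∧ ∃ P ∈ 𝔫A.minimalPrimes, P ≤ 𝔪 ∧ P ⊔ Ideal.span {g} ≤ 𝔮.asIdeal}
  have hΦsub : Φ ⊆ ⋃ P ∈ {P ∈ 𝔫A.minimalPrimes | P ≤ 𝔪},
      {𝔮 : PrimeSpectrum A | P ⊔ Ideal.span {g} ≤ 𝔮.asIdeal} := by
    rintro 𝔮 ⟨-, P, hP, hP𝔪, hle⟩
    simp only [Set.mem_iUnion, Set.mem_setOf_eq, exists_prop]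
    exact ⟨P, ⟨hP, hP𝔪⟩, hle⟩
  have hzero : ∀ P ∈ {P ∈ 𝔫A.minimalPrimes | P ≤ 𝔪},
      ringKrullDim (A ⧸ (P ⊔ Ideal.span {g})) ≤ 0 := by
    rintro P ⟨hP, hP𝔪⟩
    haveI : P.IsPrime := hP.1.1
    exact ringKrullDim_quotient_sup_span_le_zero (hdim P hP) (hcon P hP hP𝔪)
  have hΦfin : Φ.Finite := by
    refine Set.Finite.subset (Set.Finite.biUnion (hfin.subset (Set.sep_subset _ _))
      fun P hP => ?_) hΦsub
    exact (finite_and_isClosed_of_ringKrullDim_le_zero (hzero P hP)).1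
  have hΦmax : ∀ 𝔮 ∈ Φ, 𝔮.asIdeal.IsMaximal := by
    rintro 𝔮 ⟨-, P, hP, hP𝔪, hle⟩
    exact (finite_and_isClosed_of_ringKrullDim_le_zero (hzero P ⟨hP, hP𝔪⟩)).2 𝔮 hle
  have hΦ : IsClosed Φ := by
    rw [← Set.biUnion_of_singleton Φ]
    exact hΦfin.isClosed_biUnion fun 𝔮 h𝔮 =>
      (isClosed_singleton_iff_isMaximal 𝔮).mpr (hΦmax 𝔮 h𝔮)
  have h𝔪Φ : 𝔪pt ∉ Φ := fun h => h.1 rfl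
  -- the neighbourhood
  set U : Set (PrimeSpectrum (UnivQuot c)) := ιS ⁻¹' (ιA '' (Φ ∪ Ψ))ᶜ with hU
  have hUopen : IsOpen U :=
    (hιA.isClosedMap _ (hΦ.union hΨ)).isOpen_compl.preimage hιS.continuous
  -- `ιS x = ιA 𝔪`
  set x := pointOver k c a 𝔪 hg with hx
  have hιx : ιS x = ιA 𝔪pt := by
    ext1
    exact comap_mk_pointOver k c a 𝔪 hg
  refine (quasiFiniteAt_iff_exists_isOpen _ _).mpr ⟨U, hUopen, ?_, fun 𝔔 h𝔔 h𝔔U => ?_⟩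
  · -- `x ∈ U`
    change ιS x ∈ (ιA '' (Φ ∪ Ψ))ᶜ
    rw [hιx, Set.mem_compl_iff]
    rintro ⟨𝔮, h𝔮, he⟩
    rw [hιA.injective he] at h𝔮
    exact h𝔮.elim h𝔪Φ h𝔪Ψ
  · -- a point `𝔔` of the fibre in `U` is `x`
    set 𝔓 : Ideal (MvPolynomial ι A) := 𝔔.asIdeal.comap mkg with h𝔓
    have hfib : ((𝔪.comap (φ : B →+* A)).comap (eval fun i => algebraMap k B (a i))).map
        (MvPolynomial.map (φ : B →+* A)) ≤ 𝔓 := by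
      rw [h𝔓, Ideal.map_le_iff_le_comap, ← univMor_apply_asIdeal, h𝔔, univMor_pointOver]
    have hX : ∀ i, X i - C (algebraMap k A (a i)) ∈ 𝔓 := fun i => by
      rw [← map_X_sub_C k φ a i]
      refine hfib (Ideal.mem_map_of_mem _ ?_)
      simp [Ideal.mem_comap]
    have h𝔤 : univComb c ∈ 𝔓 := by
      have h0 : mkg (univComb c) = 0 :=
        Ideal.Quotient.eq_zero_iff_mem.mpr (Ideal.subset_span (Set.mem_singleton _))
      rw [h𝔓, Ideal.mem_comap, h0]
      exact zero_mem _
    -- `𝔓 = ιA 𝔮` for the prime `𝔮 = 𝔓(a) ⊇ 𝔫A + (g_a)`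
    haveI : 𝔓.IsPrime := by rw [h𝔓]; exact Ideal.comap_isPrime _ _
    set 𝔮 : Ideal A := 𝔓.map (evalParams k a) with h𝔮
    haveI h𝔮p : 𝔮.IsPrime := Ideal.map_isPrime_of_surjective (evalParams_surjective k a)
      (ker_eval_le_of_forall_X_sub_C_mem _ hX)
    have h𝔓𝔮 : 𝔓 = 𝔮.comap (evalParams k a) := (comap_eval_map_eval_eq _ hX).symm
    let 𝔮pt : PrimeSpectrum A := ⟨𝔮, h𝔮p⟩
    have hι𝔮 : ιS 𝔔 = ιA 𝔮pt := by
      ext1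
      exact h𝔓𝔮
    have h𝔫𝔮 : 𝔫A ≤ 𝔮 := by
      rw [h𝔫A, Ideal.map_le_iff_le_comap]
      intro b hb
      rw [Ideal.mem_comap]
      have h1 : C ((φ : B →+* A) b) ∈ 𝔓 := by
        have : MvPolynomial.map (φ : B →+* A) (C b : MvPolynomial ι B) = C ((φ : B →+* A) b) :=
          map_C _ _
        rw [← this]
        refine hfib (Ideal.mem_map_of_mem _ ?_)
        simpa [Ideal.mem_comap] using hb
      have h2 := Ideal.mem_map_of_mem (evalParams k a) h1
      rwa [show evalParams k a (C ((φ : B →+* A) b)) = (φ : B →+* A) b from eval_C _] at h2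
    have hg𝔮 : g ∈ 𝔮 := by
      have h2 := Ideal.mem_map_of_mem (evalParams k a) h𝔤
      rwa [evalParams_univComb] at h2
    have hnot : ιA 𝔮pt ∉ ιA '' (Φ ∪ Ψ) := by
      rw [← hι𝔮]; exact h𝔔U
    obtain ⟨P, hP, hP𝔮⟩ := Ideal.exists_minimalPrimes_le h𝔫𝔮
    by_cases hP𝔪 : P ≤ 𝔪
    · have hsup : P ⊔ Ideal.span {g} ≤ 𝔮 :=
        sup_le hP𝔮 ((Ideal.span_singleton_le_iff_mem _).mpr hg𝔮)
      by_cases heq : 𝔮pt = 𝔪pt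
      · apply hιS.injective
        rw [hι𝔮, heq, hιx]
      · exact absurd (Set.mem_image_of_mem ιA (Or.inl ⟨heq, P, hP, hP𝔪, hsup⟩)) hnot
    · refine absurd (Set.mem_image_of_mem ιA (Or.inr ?_)) hnot
      simp only [Ψ, Set.mem_iUnion, Set.mem_setOf_eq, mem_zeroLocus, SetLike.coe_subset_coe,
        exists_prop]
      exact ⟨P, ⟨hP, hP𝔪⟩, hP𝔮⟩

/-- **Conversely, if `g_a` vanishes on a positive-dimensional component `V(P)` of the fibre,
the total space is not quasi-finite at any closed point `(x, a)` with `x ∈ V(P)`**: a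
neighbourhood of `(x, a)` in its fibre contains the generic point of `V(P) × {a}`.
[cite: DeJong1996, Lemma 4.13 (proof), p. 69] -/
theorem not_quasiFiniteAt_pointOver [LocallyOfFiniteType (univMor k φ c)]
    (𝔫 : Ideal B) [h𝔫 : 𝔫.IsMaximal] {P : Ideal A}
    (hP : P ∈ (𝔫.map (φ : B →+* A)).minimalPrimes) (hdim : 1 ≤ ringKrullDim (A ⧸ P))
    (a : ι → k) (hg : ∑ i, a i • c i ∈ P) (𝔪 : Ideal A) [h𝔪 : 𝔪.IsMaximal] (hP𝔪 : P ≤ 𝔪) :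
    ¬ (univMor k φ c).QuasiFiniteAt (pointOver k c a 𝔪 (hP𝔪 hg)) := by
  intro hq
  haveI hPp : P.IsPrime := hP.1.1
  obtain ⟨U, hU, hxU, huniq⟩ := (quasiFiniteAt_iff_exists_isOpen _ _).mp hq
  let ιA : PrimeSpectrum A → PrimeSpectrum (MvPolynomial ι A) := comap (evalParams k a)
  have hιA : IsClosedEmbedding ιA :=
    isClosedEmbedding_comap_of_surjective _ _ (evalParams_surjective k a)
  let mkg := Ideal.Quotient.mk (Ideal.span {univComb c})
  let ιS : PrimeSpectrum (UnivQuot c) → PrimeSpectrum (MvPolynomial ι A) := comap mkg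
  have hιS : IsClosedEmbedding ιS :=
    isClosedEmbedding_comap_of_surjective _ _ Ideal.Quotient.mk_surjective
  obtain ⟨V, hV, hVU⟩ := hιS.isInducing.isOpen_iff.mp hU
  let 𝔪pt : PrimeSpectrum A := ⟨𝔪, h𝔪.isPrime⟩
  let Ppt : PrimeSpectrum A := ⟨P, hPp⟩
  set x := pointOver k c a 𝔪 (hP𝔪 hg) with hx
  set y := pointOver k c a P hg with hy
  have hιx : ιS x = ιA 𝔪pt := by
    ext1; exact comap_mk_pointOver k c a 𝔪 (hP𝔪 hg)
  have hιy : ιS y = ιA Ppt := by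
    ext1; exact comap_mk_pointOver k c a P hg
  -- `V(P) ∋ 𝔪` meets the open `ιA⁻¹ V ∋ 𝔪`, so its generic point lies in it
  have h𝔪V : 𝔪pt ∈ ιA ⁻¹' V := by
    change ιA 𝔪pt ∈ V
    rw [← hιx, ← Set.mem_preimage, hVU]
    exact hxU
  have hcl : 𝔪pt ∈ closure {Ppt} := (le_iff_mem_closure Ppt 𝔪pt).mp hP𝔪
  obtain ⟨z, hzV, hz⟩ := mem_closure_iff.mp hcl _ (hV.preimage hιA.continuous) h𝔪V
  rw [Set.mem_singleton_iff] at hz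
  subst hz
  have hyU : y ∈ U := by
    rw [← hVU]
    exact (show ιS y ∈ V by rw [hιy]; exact hzV)
  -- `y` and `x` have the same image `(𝔫, a)`
  have hcomapP : P.comap (φ : B →+* A) = 𝔫 :=
    (h𝔫.eq_of_le (Ideal.comap_ne_top _ hPp.ne_top) (Ideal.map_le_iff_le_comap.mp hP.1.2)).symm
  have hcomap𝔪 : 𝔪.comap (φ : B →+* A) = 𝔫 :=
    (h𝔫.eq_of_le (Ideal.comap_ne_top _ h𝔪.ne_top)
      ((Ideal.map_le_iff_le_comap.mp hP.1.2).trans (Ideal.comap_mono hP𝔪))).symm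
  have hfx : (univMor k φ c) y = (univMor k φ c) x := by
    apply PrimeSpectrum.ext
    rw [univMor_pointOver, univMor_pointOver, hcomapP, hcomap𝔪]
  have hyx : y = x := huniq y hfx hyU
  -- hence `P = 𝔪`, contradicting `dim A/P ≥ 1`
  have hP𝔪eq : P = 𝔪 := by
    have h1 : ιA Ppt = ιA 𝔪pt := by rw [← hιy, ← hιx, hyx]
    have h2 := hιA.injective h1
    exact congrArg PrimeSpectrum.asIdeal h2
  subst hP𝔪eq
  have h0 : ringKrullDim (A ⧸ P) = 0 := by
    letI := Ideal.Quotient.field P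
    convert ringKrullDim_eq_zero_of_field (A ⧸ P)
  rw [h0] at hdim
  exact absurd hdim (by simp)

end Directions

/-! ### The theorem -/

section Main

variable (k : Type u) [Field k] [IsAlgClosed k] {A : Type u} {B : Type u} [CommRing A]
  [CommRing B] [Algebra k A] [Algebra k B] [Algebra.FiniteType k A]
  (φ : B →ₐ[k] A) {ι : Type v} [Fintype ι] [DecidableEq ι] (c : ι → A)

include k in
/-- Closed points map to closed points: the contraction of a maximal ideal along a `k`-algebra
map of finitely generated algebras over an algebraically closed field is maximal (both residue
fields are `k`). [folklore] -/
theorem isMaximal_comap_algHom (𝔪 : Ideal A) [𝔪.IsMaximal] :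
    (𝔪.comap (φ : B →+* A)).IsMaximal := by
  letI := Ideal.Quotient.field 𝔪
  have hsurj : Function.Surjective ((Ideal.Quotient.mk 𝔪).comp (φ : B →+* A)) := by
    intro z
    obtain ⟨t, rfl⟩ :=
      Literature.RingTheory.KrullDimension.algebraMap_quotient_surjective_of_isMaximal k 𝔪 z
    refine ⟨algebraMap k B t, ?_⟩
    simp [Ideal.Quotient.mk_algebraMap]
  have h := RingHom.ker_isMaximal_of_surjective _ hsurj
  rwa [← RingHom.comap_ker, Ideal.mk_ker] at h

include k in
/-- **A generic member of the linear system contains no component of any closed fibre.**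
Let `k` be algebraically closed, `φ : B → A` a `k`-algebra map of finitely generated algebras
with `dim A ≤ e` and `c : ι → A` finitely many functions such that, for every closed point `𝔫`
of `Spec B`, every irreducible component `V(P)` of the fibre `V(𝔫A)` is a curve
(`dim A/P = 1`) and the restrictions of the `cᵢ` to it span a `k`-space of dimension
`≥ e + 1`. Then for some non-zero `h ∈ k[T]`, whenever `h(a) ≠ 0` the function `g_a = Σᵢ aᵢ cᵢ`
lies in no minimal prime of any `𝔫A`, i.e. `V(g_a)` contains no component of any closed fibre
of `Spec A → Spec B` (de Jong: "`pr₁(T) ≠ 𝐏^∨`"; the set of bad `a` over each `x ∈ Spec A` is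
the union of the linear spaces `{a | g_a ∈ P}`, `x ∈ V(P)`, of codimension `≥ e + 1`, and the
bad `(x, a)` form the closed non-quasi-finite locus of the universal member).
[cite: DeJong1996, Lemma 4.13 (proof), pp. 69–70] -/
theorem exists_ne_zero_forall_sum_smul_notMem_minimalPrimes (e : ℕ) (hA : ringKrullDim A ≤ e)
    (hdim : ∀ 𝔫 : Ideal B, 𝔫.IsMaximal →
      ∀ P ∈ (𝔫.map (φ : B →+* A)).minimalPrimes, ringKrullDim (A ⧸ P) = 1)
    (hspan : ∀ 𝔫 : Ideal B, 𝔫.IsMaximal → ∀ P ∈ (𝔫.map (φ : B →+* A)).minimalPrimes,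
      e + 1 ≤ Module.finrank k
        (Submodule.span k (Set.range fun i => Ideal.Quotient.mk P (c i)))) :
    ∃ h : MvPolynomial ι k, h ≠ 0 ∧ ∀ a : ι → k, eval a h ≠ 0 →
      ∀ 𝔫 : Ideal B, 𝔫.IsMaximal → ∀ P ∈ (𝔫.map (φ : B →+* A)).minimalPrimes,
        ∑ i, a i • c i ∉ P := by
  classical
  haveI : IsNoetherianRing A := Algebra.FiniteType.isNoetherianRing k A
  haveI : LocallyOfFiniteType (univMor k φ c) := locallyOfFiniteType_univMor k φ c
  -- the non-quasi-finite locus `E` of the total space and its ideal `J ⊆ A[T]`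
  let mkg := Ideal.Quotient.mk (Ideal.span {univComb c})
  set E : Set (PrimeSpectrum (UnivQuot c)) :=
    {x | ¬ (univMor k φ c).QuasiFiniteAt x} with hE
  have hEcl : IsClosed E := (univMor k φ c).isOpen_quasiFiniteAt.isClosed_compl
  set J : Ideal (MvPolynomial ι A) := (vanishingIdeal E).comap mkg with hJ
  have hJE : ∀ x ∈ E, J ≤ x.asIdeal.comap mkg := fun x hx =>
    Ideal.comap_mono ((vanishingIdeal_anti_mono (Set.singleton_subset_iff.mpr hx)).trans
      (vanishingIdeal_singleton x).le)
  have h𝔤J : univComb c ∈ J := by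
    rw [hJ, Ideal.mem_comap,
      Ideal.Quotient.eq_zero_iff_mem.mpr (Ideal.subset_span (Set.mem_singleton _))]
    exact zero_mem _
  -- the linear maps `a ↦ g_a mod P`
  let Λ : (P : Ideal A) → ((ι → k) →ₗ[k] (A ⧸ P)) := fun P =>
    Fintype.linearCombination k fun i => Ideal.Quotient.mk P (c i)
  have hΛ : ∀ (P : Ideal A) (a : ι → k), Λ P a = Ideal.Quotient.mk P (∑ i, a i • c i) := by
    intro P a
    simp only [Λ, Fintype.linearCombination_apply, map_sum]
    rfl
  -- the fibre hypothesis of generic avoidance over a closed point `𝔪`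
  have hfib : ∀ 𝔪 : Ideal (A), 𝔪.IsMaximal →
      ∃ s : Finset (Ideal (MvPolynomial ι k)),
        (∀ 𝔟 ∈ s, ringKrullDim (MvPolynomial ι k ⧸ 𝔟) + (e + 1 : ℕ) ≤ Nat.card ι) ∧
        ∀ 𝔐 : Ideal (MvPolynomial ι A), 𝔐.IsMaximal → J ≤ 𝔐 →
          𝔐.comap (C : A →+* MvPolynomial ι A) = 𝔪 →
            ∃ 𝔟 ∈ s, 𝔟.map (MvPolynomial.map (algebraMap k A)) ≤ 𝔐 := by
    intro 𝔪 h𝔪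
    set 𝔫 : Ideal B := 𝔪.comap (φ : B →+* A) with h𝔫
    haveI h𝔫max : 𝔫.IsMaximal := isMaximal_comap_algHom k φ 𝔪
    have hfin : (𝔫.map (φ : B →+* A)).minimalPrimes.Finite :=
      (𝔫.map (φ : B →+* A)).finite_minimalPrimes_of_isNoetherianRing
    refine ⟨(hfin.toFinset.filter (· ≤ 𝔪)).image fun P =>
      Literature.RingTheory.KrullDimension.linIdeal (Λ P), ?_, ?_⟩
    · intro 𝔟 h𝔟
      simp only [Finset.mem_image, Finset.mem_filter, Set.Finite.mem_toFinset] at h𝔟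
      obtain ⟨P, ⟨hP, -⟩, rfl⟩ := h𝔟
      have hr : e + 1 ≤ Module.finrank k (LinearMap.range (Λ P)) := by
        rw [show LinearMap.range (Λ P) = _ from Fintype.range_linearCombination k _]
        exact hspan 𝔫 h𝔫max P hP
      have := Literature.RingTheory.KrullDimension.ringKrullDim_quotient_linIdeal_add_le (Λ P) hr
      rwa [← Nat.card_eq_fintype_card] at this
    · intro 𝔐 h𝔐 hJ𝔐 h𝔐𝔪
      haveI : Algebra.FiniteType k (MvPolynomial ι A) :=
        (inferInstance : Algebra.FiniteType k A).trans inferInstance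
      -- coordinates `a` of the closed point `𝔐`
      have ha' := fun i =>
        Literature.RingTheory.KrullDimension.exists_sub_algebraMap_mem_of_isMaximal k 𝔐
          (X i : MvPolynomial ι A)
      choose a ha using ha'
      have hX : ∀ i, X i - C (algebraMap k A (a i)) ∈ 𝔐 := fun i => by
        rw [← MvPolynomial.algebraMap_apply]; exact ha i
      have h𝔐eq : 𝔐 = 𝔪.comap (evalParams k a) := by
        rw [← h𝔐𝔪]; exact eq_comap_eval_comap_C _ hX
      have hg : ∑ i, a i • c i ∈ 𝔪 := by
        rw [← evalParams_univComb k c a, ← Ideal.mem_comap, ← h𝔐eq]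
        exact hJ𝔐 h𝔤J
      -- the point `(x, a)` lies in the closed set `E`
      have hxE : pointOver k c a 𝔪 hg ∈ E := by
        have hsub : vanishingIdeal E ≤ (pointOver k c a 𝔪 hg).asIdeal := by
          have h1 : vanishingIdeal E = J.map mkg :=
            (Ideal.map_comap_of_surjective mkg Ideal.Quotient.mk_surjective _).symm
          rw [h1]
          change J.map mkg ≤ (𝔪.comap (evalParams k a)).map mkg
          exact Ideal.map_mono (h𝔐eq ▸ hJ𝔐)
        have h2 : pointOver k c a 𝔪 hg ∈ zeroLocus (vanishingIdeal E : Set (UnivQuot c)) := by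
          rwa [mem_zeroLocus, SetLike.coe_subset_coe]
        rwa [zeroLocus_vanishingIdeal_eq_closure, hEcl.closure_eq] at h2
      obtain ⟨P, hP, hP𝔪, hgP⟩ := exists_mem_minimalPrimes_of_not_quasiFiniteAt k φ c a 𝔪 hg
        (fun P hP => (hdim 𝔫 h𝔫max P hP).le) hxE
      refine ⟨Literature.RingTheory.KrullDimension.linIdeal (Λ P), ?_, ?_⟩
      · simp only [Finset.mem_image, Finset.mem_filter, Set.Finite.mem_toFinset]
        exact ⟨P, ⟨hP, hP𝔪⟩, rfl⟩
      · have hker : Λ P a = 0 := by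
          rw [hΛ, Ideal.Quotient.eq_zero_iff_mem]
          exact hgP
        have hle := Literature.RingTheory.KrullDimension.linIdeal_le_ker_eval (Λ P) hker
        rw [Ideal.map_le_iff_le_comap]
        intro q hq
        rw [Ideal.mem_comap, h𝔐eq, Ideal.mem_comap, evalParams_map_algebraMap,
          (RingHom.mem_ker.mp (hle hq)), map_zero]
        exact zero_mem _
  -- generic avoidance
  obtain ⟨h, hh0, hh⟩ :=
    Literature.RingTheory.KrullDimension.exists_ne_zero_forall_mem_of_isMaximal k e hA J hfib
  refine ⟨h, hh0, fun a ha 𝔫 h𝔫 P hP hgP => ?_⟩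
  haveI hPp : P.IsPrime := hP.1.1
  obtain ⟨𝔪, h𝔪, hP𝔪⟩ := Ideal.exists_le_maximal P hPp.ne_top
  have hx : pointOver k c a 𝔪 (hP𝔪 hgP) ∈ E :=
    not_quasiFiniteAt_pointOver k φ c 𝔫 hP (le_of_eq (hdim 𝔫 h𝔫 P hP).symm) a hgP 𝔪 hP𝔪
  have hJ𝔐 : J ≤ 𝔪.comap (evalParams k a) := by
    rw [← comap_mk_pointOver k c a 𝔪 (hP𝔪 hgP)]
    exact hJE _ hx
  haveI : (𝔪.comap (evalParams k a)).IsMaximal :=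
    Ideal.comap_isMaximal_of_surjective _ (evalParams_surjective k a)
  have h1 := hh _ this hJ𝔐
  rw [Ideal.mem_comap, evalParams_map_algebraMap] at h1
  exact h𝔪.ne_top (Ideal.eq_top_of_isUnit_mem _ h1 ((IsUnit.mk0 _ ha).map _))

end Main

end Literature.AlgebraicGeometry.Resolution
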